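import Summits.QuantumFields.BalabanUV.Beta.GAN24.DirichletRingHessianWindow

/-!
# `BalabanUV.Beta.GAN24.DirichletRingLayerCake` — binder row G-an2-4 / (CONV-C), road P2 PART IV, leaf L12 (model), part 2: THE DYADIC LAYER CAKE
# `Σ_{ρ≤2^{J+3}, x∉Q} ρ·(|∂₁²U|²+|∂₂²U|²) ≤ 16·Ẽ_4 + Σ_{j≤J} 2^{j+3}·[2·SG_n + 84800·Ẽ_{20·2^j+1}/4^j]` (unit b2b-balaban-gan24-p2, gen 25, v1)

HONEST FRAMING (cell contract, verbatim): «discharging `BetaPertH` makes Bałaban's UV stability UNCONDITIONAL — a real constructive-QFT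
result; it is NOT the continuum limit and NOT the Clay problem.»  Pure bookkeeping step between the window estimate
`DirichletRingHessianWindow.window_hessian_le` and binder (A) at a re-entrant vertex (plan `HOME/b2b-balaban-gan24-p2/gen25/RING-LEMMA-KERNEL.md` §6):
 * §1 `sqSum_eq_of_vanish` (a site sum does not see sites beyond the support), `sqSum_add`/`sqSum_const_mul`/`sqSum_range_sum`, `hess_le_two_nbr`
   (`|a−2b+c|²`-type: the Hessian at a site is at most twice the neighbour differences);
 * §2 `inner_le` — the rings `ρ ≤ 4`: `Σ offQ·𝟙[ρ≤4]·hess ≤ 4·Ẽ_4`; `window_le` — the window sum taken over `Q_n` equals the one over `Q_{20L+1}`;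
 * §3 `layer_cake` — for an integer `1 ≤ ρ ≤ 2^{J+3}`: `ρ ≤ 4·𝟙[ρ ≤ 4] + Σ_{j≤J} 2^{j+3}·𝟙[4·2^j+1 ≤ ρ ≤ 10·2^j−1]` (the dyadic windows
   `[2^{j+2}+1, 2^{j+3}]` sit inside the plateaux of the cut-offs `χ_{2^j}`);
 * §4 **`weighted_hessian_le_sum`** — for `U = 0` on the quadrant, `ΔU = G` on `Q_n ∖ Q` and `20·2^J + 1 ≤ n`:
   `Σ_{Q_n} offQ·w_J·(|∂₁²U|²+|∂₂²U|²) ≤ 16·Et U 4 + Σ_{j<J+1} 2^{j+3}·(2·SG_n + 84800/(2^j)²·Et U (20·2^j+1))`, `w_J = ρ·𝟙[ρ ≤ 2^{J+3}]`.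
The decay `DirichletRingDecay.ring_energy_decay` then turns the right side into `C₁·n·SG_n + C₂(γ)·M_n/n` (part 3, the geometric sum; NOT here).

ABSOLUTE RULE (cell, verbatim): «No internally-minted statement may enter as a cited fact. Every hypothesis is either kernel-proved in
this package or a verbatim quotation of a PUBLISHED theorem with page reference. The manuscript(s) under audit are NOT citable for
their own disputed steps — they are the thing under adjudication; programme-internal (2001/route/tribunal) claims are never citable.»
[folklore] finite sums; nothing printed is a hypothesis.  NOT CLAIMED: (A) with its final constants, (A)/(B) on the torus, NE2, (CONV-C), `BetaPertH`,
continuum, Clay.  «not in print; our proof attempt».  HONEST DEPENDENCY: continuum YM on T⁴ ⇐ BetaPertH ∧ nine spine estimates (0/9 proved); BetaPertH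
⇐ (D1) ∧ (D4) ∧ CAP+tail; G-an2-4 gates asym, D1 and NE2/3/4.
-/

noncomputable section

open scoped BigOperators
open Finset

namespace Summit.QuantumFields.BalabanUV.Beta.GAN24.DirichletRingLayerCake

open DirichletRingEnergies (Et sqSum lap Et_nonneg sqSum_succ sqSum_nonneg)
open DirichletRingHessianIdentity (d1 d2 offQ offQ_nonneg offQ_le_one)
open DirichletRingCutoff (tIdx one_le_tIdx)
open DirichletRingHessianWindow (rho win nbr nbr_sqSum_le window_hessian_le sqSum_le_of_le)

variable (U : ℤ → ℤ → ℂ)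

/-! ## §1 Site-sum bookkeeping -/

/-- a site sum over `Q_m` of a function vanishing outside `Q_k` equals the sum over `Q_k` (`k ≤ m`). [folklore] -/
theorem sqSum_eq_of_vanish (f : ℤ → ℤ → ℝ) {k m : ℕ} (hkm : k ≤ m)
    (hf : ∀ i j : ℤ, ((k : ℤ) < tIdx i ∨ (k : ℤ) < tIdx j) → f i j = 0) : sqSum f m = sqSum f k := by
  induction m, hkm using Nat.le_induction with
  | base => rfl
  | succ m hkm ih =>
      rw [sqSum_succ, ih]
      have t1 : ∀ s : ℕ, f (-((m + 1 : ℕ) : ℤ) + s) (-((m + 1 : ℕ) : ℤ)) = 0 := fun s =>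
        hf _ _ (Or.inr (by unfold tIdx; split_ifs <;> omega))
      have t2 : ∀ s : ℕ, f (-((m + 1 : ℕ) : ℤ) + s) ((m : ℕ) : ℤ) = 0 := fun s =>
        hf _ _ (Or.inr (by unfold tIdx; split_ifs <;> omega))
      have t3 : ∀ t : ℕ, f (-((m + 1 : ℕ) : ℤ)) (-(m : ℤ) + t) = 0 := fun t =>
        hf _ _ (Or.inl (by unfold tIdx; split_ifs <;> omega))
      have t4 : ∀ t : ℕ, f ((m : ℕ) : ℤ) (-(m : ℤ) + t) = 0 := fun t =>
        hf _ _ (Or.inl (by unfold tIdx; split_ifs <;> omega))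
      simp only [t1, t2, t3, t4, sum_const_zero, add_zero]

/-- additivity of site sums. [folklore] -/
theorem sqSum_add (f g : ℤ → ℤ → ℝ) (k : ℕ) : sqSum (fun i j => f i j + g i j) k = sqSum f k + sqSum g k := by
  simp only [sqSum, sum_add_distrib]

/-- homogeneity of site sums. [folklore] -/
theorem sqSum_const_mul (c : ℝ) (f : ℤ → ℤ → ℝ) (k : ℕ) : sqSum (fun i j => c * f i j) k = c * sqSum f k := by
  simp only [sqSum, mul_sum]

/-- site sums commute with finite `range` sums. [folklore] -/
theorem sqSum_range_sum (g : ℕ → ℤ → ℤ → ℝ) (J k : ℕ) :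
    sqSum (fun i j => ∑ m ∈ range J, g m i j) k = ∑ m ∈ range J, sqSum (g m) k := by
  induction J with
  | zero => simp [sqSum]
  | succ J ih =>
      rw [sum_range_succ, ← ih, ← sqSum_add]
      refine sum_congr rfl fun t _ => sum_congr rfl fun s _ => ?_
      beta_reduce
      rw [sum_range_succ]

/-- the Hessian at a site is at most twice the neighbour differences: `|∂₁²U|² + |∂₂²U|² ≤ 2·nbr`. [folklore] -/
theorem hess_le_two_nbr (i j : ℤ) : ‖d1 U i j‖ ^ 2 + ‖d2 U i j‖ ^ 2 ≤ 2 * nbr U i j := by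
  have e1 : d1 U i j = (U (i + 1) j - U i j) + (U (i - 1) j - U i j) := by rw [d1]; ring
  have e2 : d2 U i j = (U i (j + 1) - U i j) + (U i (j - 1) - U i j) := by rw [d2]; ring
  have h1 := norm_add_le (U (i + 1) j - U i j) (U (i - 1) j - U i j)
  have h2 := norm_add_le (U i (j + 1) - U i j) (U i (j - 1) - U i j)
  rw [← e1] at h1; rw [← e2] at h2
  rw [nbr]
  nlinarith [norm_nonneg (d1 U i j), norm_nonneg (d2 U i j), norm_nonneg (U (i + 1) j - U i j), norm_nonneg (U (i - 1) j - U i j),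
    norm_nonneg (U i (j + 1) - U i j), norm_nonneg (U i (j - 1) - U i j),
    sq_nonneg (‖U (i + 1) j - U i j‖ - ‖U (i - 1) j - U i j‖), sq_nonneg (‖U i (j + 1) - U i j‖ - ‖U i (j - 1) - U i j‖)]

/-! ## §2 The innermost rings and the windows, as sums over `Q_n` -/

/-- the indicator of the innermost rings `ρ ≤ 4`. [folklore] -/
def inner4 (i j : ℤ) : ℝ := if rho i j ≤ 4 then 1 else 0

/-- **the innermost rings**: `Σ_{Q_n} offQ·𝟙[ρ≤4]·hess ≤ 4·Ẽ_4` (`n ≥ 4`). [folklore] -/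
theorem inner_le {n : ℕ} (hn : 4 ≤ n) :
    sqSum (fun i j => offQ i j * inner4 i j * (‖d1 U i j‖ ^ 2 + ‖d2 U i j‖ ^ 2)) n ≤ 4 * Et U 4 := by
  rw [sqSum_eq_of_vanish _ hn]
  · calc sqSum (fun i j => offQ i j * inner4 i j * (‖d1 U i j‖ ^ 2 + ‖d2 U i j‖ ^ 2)) 4
        ≤ sqSum (fun i j => 2 * nbr U i j) 4 := by
          refine sqSum_le_of_le (fun i j => ?_) 4
          have h0 : 0 ≤ ‖d1 U i j‖ ^ 2 + ‖d2 U i j‖ ^ 2 := by positivity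
          have hi : inner4 i j ≤ 1 := by unfold inner4; split_ifs <;> norm_num
          have hi0 : 0 ≤ inner4 i j := by unfold inner4; split_ifs <;> norm_num
          have hoi : offQ i j * inner4 i j ≤ 1 := by
            calc offQ i j * inner4 i j ≤ 1 * 1 := mul_le_mul (offQ_le_one i j) hi hi0 zero_le_one
              _ = 1 := one_mul 1
          calc offQ i j * inner4 i j * (‖d1 U i j‖ ^ 2 + ‖d2 U i j‖ ^ 2) ≤ ‖d1 U i j‖ ^ 2 + ‖d2 U i j‖ ^ 2 :=
                mul_le_of_le_one_left h0 hoi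
            _ ≤ 2 * nbr U i j := hess_le_two_nbr U i j
      _ = 2 * sqSum (nbr U) 4 := sqSum_const_mul 2 _ 4
      _ ≤ 2 * (2 * Et U 4) := mul_le_mul_of_nonneg_left (nbr_sqSum_le U (by norm_num)) (by norm_num)
      _ = 4 * Et U 4 := by ring
  · intro i j h
    push_cast at h
    have : ¬ rho i j ≤ 4 := fun h4 => by
      have h4' := max_le_iff.mp (show max (tIdx i) (tIdx j) ≤ 4 from h4)
      rcases h with h | h <;> omega
    simp only [inner4, this, if_false, mul_zero, zero_mul]

/-- **a window sum over `Q_n` is the window sum over `Q_{20L+1}`**, hence bounded by the window estimate. [folklore] -/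
theorem window_le {L n : ℕ} (hL : 1 ≤ L) (hLn : 20 * L + 1 ≤ n) (G : ℤ → ℤ → ℂ)
    (hU : ∀ s t : ℤ, 0 ≤ s → 0 ≤ t → U s t = 0)
    (hEq : ∀ i j : ℤ, -(n : ℤ) ≤ i → i < n → -(n : ℤ) ≤ j → j < n → ¬(0 ≤ i ∧ 0 ≤ j) → lap U i j = G i j) :
    sqSum (fun i j => offQ i j * win L i j * (‖d1 U i j‖ ^ 2 + ‖d2 U i j‖ ^ 2)) n
      ≤ 2 * sqSum (fun i j => ‖G i j‖ ^ 2) n + 84800 / (L : ℝ) ^ 2 * Et U (20 * L + 1) := by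
  rw [sqSum_eq_of_vanish _ hLn]
  · exact window_hessian_le U hL hLn G hU hEq
  · intro i j h
    push_cast at h
    have hbig : 10 * (L : ℤ) - 1 < rho i j := by
      unfold rho
      rcases h with h | h
      · exact lt_of_lt_of_le (by omega) (le_max_left _ _)
      · exact lt_of_lt_of_le (by omega) (le_max_right _ _)
    have : ¬ (4 * (L : ℤ) + 1 ≤ rho i j ∧ rho i j ≤ 10 * (L : ℤ) - 1) := fun hw => by omega
    simp only [win, this, if_false, mul_zero, zero_mul]

/-! ## §3 The dyadic layer cake for the weight `ρ` -/

/-- **layer cake**: for an integer `1 ≤ ρ ≤ 2^{J+3}`,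
`ρ ≤ 4·𝟙[ρ ≤ 4] + Σ_{j≤J} 2^{j+3}·𝟙[4·2^j+1 ≤ ρ ≤ 10·2^j−1]`. [folklore] -/
theorem layer_cake (J : ℕ) (ρ : ℤ) (hρ : ρ ≤ (2 : ℤ) ^ (J + 3)) :
    (ρ : ℝ) ≤ 4 * (if ρ ≤ 4 then (1 : ℝ) else 0)
      + ∑ j ∈ range (J + 1), (2 : ℝ) ^ (j + 3) * (if 4 * (2 : ℤ) ^ j + 1 ≤ ρ ∧ ρ ≤ 10 * (2 : ℤ) ^ j - 1 then (1 : ℝ) else 0) := by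
  have hterm0 : ∀ j, 0 ≤ (2 : ℝ) ^ (j + 3) * (if 4 * (2 : ℤ) ^ j + 1 ≤ ρ ∧ ρ ≤ 10 * (2 : ℤ) ^ j - 1 then (1 : ℝ) else 0) := fun j => by
    split_ifs <;> positivity
  induction J with
  | zero =>
      rw [zero_add, sum_range_one]
      by_cases h4 : ρ ≤ 4
      · rw [if_pos h4]
        have : (ρ : ℝ) ≤ 4 := by exact_mod_cast h4
        linarith [hterm0 0]
      · rw [if_neg h4]
        have hw : 4 * (2 : ℤ) ^ 0 + 1 ≤ ρ ∧ ρ ≤ 10 * (2 : ℤ) ^ 0 - 1 := by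
          constructor <;> simp at hρ ⊢ <;> omega
        rw [if_pos hw]
        have : (ρ : ℝ) ≤ 8 := by exact_mod_cast (by simpa using hρ)
        norm_num; linarith
  | succ J ih =>
      rw [sum_range_succ]
      by_cases h : ρ ≤ (2 : ℤ) ^ (J + 3)
      · linarith [ih h, hterm0 (J + 1)]
      · have h := not_le.mp h
        -- the top window `j = J+1` is on
        have e1 : (4 : ℤ) * 2 ^ (J + 1) = 2 ^ (J + 3) := by ring
        have e2 : (2 : ℤ) ^ (J + 1 + 3) = 8 * 2 ^ (J + 1) := by ring
        have hX : (1 : ℤ) ≤ 2 ^ (J + 1) := one_le_pow₀ (by norm_num)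
        have hw : 4 * (2 : ℤ) ^ (J + 1) + 1 ≤ ρ ∧ ρ ≤ 10 * (2 : ℤ) ^ (J + 1) - 1 := by
          constructor
          · rw [e1]; omega
          · rw [e2] at hρ; omega
        rw [if_pos hw, mul_one]
        have hρR : (ρ : ℝ) ≤ (2 : ℝ) ^ (J + 1 + 3) := by exact_mod_cast hρ
        have hsum0 : 0 ≤ ∑ j ∈ range (J + 1), (2 : ℝ) ^ (j + 3) * (if 4 * (2 : ℤ) ^ j + 1 ≤ ρ ∧ ρ ≤ 10 * (2 : ℤ) ^ j - 1 then (1 : ℝ) else 0) :=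
          sum_nonneg fun j _ => hterm0 j
        have hin0 : 0 ≤ 4 * (if ρ ≤ 4 then (1 : ℝ) else 0) := by split_ifs <;> norm_num
        linarith

/-! ## §4 The weighted Hessian as a finite sum of window estimates -/

/-- the weight `w_J = ρ·𝟙[ρ ≤ 2^{J+3}]`. [folklore] -/
def wJ (J : ℕ) (i j : ℤ) : ℝ := if rho i j ≤ (2 : ℤ) ^ (J + 3) then (rho i j : ℝ) else 0

/-- **THE WEIGHTED HESSIAN AS A SUM OF WINDOW ESTIMATES** (leaf L12, model, part 2): for `U = 0` on the quadrant, `ΔU = G` on `Q_n ∖ Q`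
and `20·2^J + 1 ≤ n`,
`Σ_{Q_n} offQ·w_J·(|∂₁²U|²+|∂₂²U|²) ≤ 16·Ẽ_4 + Σ_{j<J+1} 2^{j+3}·(2·SG_n + 84800/(2^j)²·Ẽ_{20·2^j+1})`. [folklore] -/
theorem weighted_hessian_le_sum {n J : ℕ} (hJ : 20 * 2 ^ J + 1 ≤ n) (G : ℤ → ℤ → ℂ)
    (hU : ∀ s t : ℤ, 0 ≤ s → 0 ≤ t → U s t = 0)
    (hEq : ∀ i j : ℤ, -(n : ℤ) ≤ i → i < n → -(n : ℤ) ≤ j → j < n → ¬(0 ≤ i ∧ 0 ≤ j) → lap U i j = G i j) :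
    sqSum (fun i j => offQ i j * wJ J i j * (‖d1 U i j‖ ^ 2 + ‖d2 U i j‖ ^ 2)) n
      ≤ 16 * Et U 4 + ∑ j ∈ range (J + 1), (2 : ℝ) ^ (j + 3)
          * (2 * sqSum (fun i j => ‖G i j‖ ^ 2) n + 84800 / (((2 ^ j : ℕ) : ℝ)) ^ 2 * Et U (20 * 2 ^ j + 1)) := by
  -- pointwise layer cake
  have hpt : ∀ i j, offQ i j * wJ J i j * (‖d1 U i j‖ ^ 2 + ‖d2 U i j‖ ^ 2)
      ≤ 4 * (offQ i j * inner4 i j * (‖d1 U i j‖ ^ 2 + ‖d2 U i j‖ ^ 2))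
        + ∑ m ∈ range (J + 1), (2 : ℝ) ^ (m + 3) * (offQ i j * win (2 ^ m) i j * (‖d1 U i j‖ ^ 2 + ‖d2 U i j‖ ^ 2)) := by
    intro i j
    have h0 : 0 ≤ offQ i j * (‖d1 U i j‖ ^ 2 + ‖d2 U i j‖ ^ 2) := mul_nonneg (offQ_nonneg i j) (by positivity)
    have hwin : ∀ m, win (2 ^ m) i j = (if 4 * (2 : ℤ) ^ m + 1 ≤ rho i j ∧ rho i j ≤ 10 * (2 : ℤ) ^ m - 1 then (1 : ℝ) else 0) := by
      intro m; unfold win; push_cast; rfl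
    have hre : 4 * (offQ i j * inner4 i j * (‖d1 U i j‖ ^ 2 + ‖d2 U i j‖ ^ 2))
        + ∑ m ∈ range (J + 1), (2 : ℝ) ^ (m + 3) * (offQ i j * win (2 ^ m) i j * (‖d1 U i j‖ ^ 2 + ‖d2 U i j‖ ^ 2))
        = (offQ i j * (‖d1 U i j‖ ^ 2 + ‖d2 U i j‖ ^ 2)) * (4 * inner4 i j
          + ∑ m ∈ range (J + 1), (2 : ℝ) ^ (m + 3) * (if 4 * (2 : ℤ) ^ m + 1 ≤ rho i j ∧ rho i j ≤ 10 * (2 : ℤ) ^ m - 1 then (1 : ℝ) else 0)) := by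
      simp only [hwin]
      conv_rhs => rw [mul_add, Finset.mul_sum]
      congr 1
      · ring
      · exact sum_congr rfl fun m _ => by ring
    rw [hre]
    unfold wJ
    split_ifs with hρ
    · have hlc := layer_cake J (rho i j) hρ
      unfold inner4
      calc offQ i j * (rho i j : ℝ) * (‖d1 U i j‖ ^ 2 + ‖d2 U i j‖ ^ 2) = (offQ i j * (‖d1 U i j‖ ^ 2 + ‖d2 U i j‖ ^ 2)) * (rho i j : ℝ) := by
            ring
        _ ≤ _ := mul_le_mul_of_nonneg_left hlc h0
    · rw [mul_zero, zero_mul]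
      refine mul_nonneg h0 (add_nonneg ?_ (sum_nonneg fun m _ => ?_))
      · unfold inner4; split_ifs <;> norm_num
      · split_ifs <;> positivity
  -- sum over the square
  have h1 := sqSum_le_of_le hpt n
  rw [sqSum_add, sqSum_const_mul, sqSum_range_sum] at h1
  simp only [sqSum_const_mul] at h1
  -- the pieces
  have hn4 : 4 ≤ n := le_trans (by have := Nat.one_le_two_pow (n := J); omega) hJ
  have hin := inner_le U hn4
  have hwin : ∀ m ∈ range (J + 1), (2 : ℝ) ^ (m + 3) * sqSum (fun i j => offQ i j * win (2 ^ m) i j * (‖d1 U i j‖ ^ 2 + ‖d2 U i j‖ ^ 2)) n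
      ≤ (2 : ℝ) ^ (m + 3) * (2 * sqSum (fun i j => ‖G i j‖ ^ 2) n + 84800 / (((2 ^ m : ℕ) : ℝ)) ^ 2 * Et U (20 * 2 ^ m + 1)) := by
    intro m hm
    have hm' := mem_range.mp hm
    have hL : 1 ≤ 2 ^ m := Nat.one_le_two_pow
    have hLn : 20 * 2 ^ m + 1 ≤ n := le_trans (by
      have := Nat.pow_le_pow_right (show 0 < 2 by norm_num) (show m ≤ J by omega); omega) hJ
    exact mul_le_mul_of_nonneg_left (window_le U hL hLn G hU hEq) (by positivity)
  calc _ ≤ _ := h1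
    _ ≤ 16 * Et U 4 + ∑ j ∈ range (J + 1), (2 : ℝ) ^ (j + 3)
          * (2 * sqSum (fun i j => ‖G i j‖ ^ 2) n + 84800 / (((2 ^ j : ℕ) : ℝ)) ^ 2 * Et U (20 * 2 ^ j + 1)) := by
        have := sum_le_sum hwin
        linarith

end Summit.QuantumFields.BalabanUV.Beta.GAN24.DirichletRingLayerCake

end
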